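import Literature.AlgebraicGeometry.Resolution.Blowups
import HarnessLib

/-!
# Blow-ups in stable centres: automorphisms and group actions lift (Görtz–Wedhorn I, Prop. 13.91 (1))

Topic: `Literature/AlgebraicGeometry/Resolution`; companion of `Blowups.lean` (the universal
property `IsBlowup π I`, Görtz–Wedhorn I, Def. 13.90). Functoriality of blowing up (GW Prop. 13.91
(1): a morphism `f : X₁ → X` induces `Bl(f) : Bl_{f⁻¹I}(X₁) → Bl_I(X)` over `f`) specialised to
AUTOMORPHISMS PRESERVING THE CENTRE, which is the form equivariant birational geometry uses
("blow up a `G`-stable centre; the action lifts"):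

* `IsBlowup.liftAut` — `σ ∈ Aut X` with `σ⁻¹I = I` (`I.comap σ.hom = I`) lifts to a unique
  automorphism `σ♯` of any blow-up `π : X' → X` along `I` with `σ♯ ≫ π = π ≫ σ`
  (`liftAut_hom_comp`, `liftAut_unique`, `liftAut_one`);
* `IsBlowup.liftAction` — an action `ρ : G →* Aut X` preserving `I` lifts to an action
  `G →* Aut X'` making `π` equivariant (`liftAction_hom_comp`), uniquely (`liftAction_unique`),
  and over the same base when `ρ` is (`liftAction_hom_comp_comp`).

All proofs are from the universal property (`IsBlowup.lift`, `lift_comp`, `lift_unique`,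
`eq_id_of_comp_eq`); the two `def`s are constructions with bodies. Requested by the lead of crux
`WildQuotients.WildQuotientResolution` (stmt-ResolutionOfSingularities-15640, line `Sketch`, stub
`stub_phaseZero`: equivariant blow-ups of a regular `G`-scheme in regular `G`-stable centres).
Mathlib (pin v4.32.0) has no blow-ups of schemes; searched: `IsBlowup`, `Aut`, "equivariant" in
the project (no prior lift lemma).

## References

* U. Görtz, T. Wedhorn, *Algebraic Geometry I: Schemes*, 2nd ed., Springer 2020, (13.19),
  Def. 13.90 and Prop. 13.91 (1), p. 414. [GortzWedhorn2020]
-/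

noncomputable section

open CategoryTheory AlgebraicGeometry

namespace Literature.AlgebraicGeometry.Resolution

universe u

namespace IsBlowup

variable {X' X : Scheme.{u}} {π : X' ⟶ X} {I : X.IdealSheafData}

/-! ## One automorphism -/

/-- If `σ ∈ Aut X` preserves the ideal sheaf `I` (`σ⁻¹ I = I`) then so does `σ⁻¹`. [folklore] -/
theorem comap_aut_inv_eq (σ : Aut X) (hσ : I.comap σ.hom = I) : I.comap σ.inv = I := by
  conv_lhs => rw [← hσ]
  rw [← Scheme.IdealSheafData.comap_comp, Iso.inv_hom_id, Scheme.IdealSheafData.comap_id]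

/-- For a blow-up `π` of `X` along `I` and `σ ∈ Aut X` preserving `I`, the composite `π ≫ σ`
pulls the centre back to an effective Cartier divisor (namely the exceptional divisor of `π`).
[folklore] -/
theorem isEffectiveCartier_comap_comp_aut (h : IsBlowup π I) (σ : Aut X)
    (hσ : I.comap σ.hom = I) : IsEffectiveCartier (I.comap (π ≫ σ.hom)) := by
  rw [Scheme.IdealSheafData.comap_comp, hσ]
  exact h.isEffectiveCartier

/-- **An automorphism preserving the centre lifts to the blow-up** (Görtz–Wedhorn I, Prop. 13.91
(1), for an automorphism `σ` with `σ⁻¹I = I`): the unique `σ♯ ∈ Aut X'` with `σ♯ ≫ π = π ≫ σ`; its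
inverse is the lift of `σ⁻¹`. [cite: GortzWedhorn2020, Prop. 13.91 (1)] -/
def liftAut (h : IsBlowup π I) (σ : Aut X) (hσ : I.comap σ.hom = I) : Aut X' where
  hom := h.lift (π ≫ σ.hom) (h.isEffectiveCartier_comap_comp_aut σ hσ)
  inv := h.lift (π ≫ σ.inv) (h.isEffectiveCartier_comap_comp_aut σ.symm (comap_aut_inv_eq σ hσ))
  hom_inv_id := h.eq_id_of_comp_eq (by
    rw [Category.assoc, h.lift_comp (π ≫ σ.inv), ← Category.assoc, h.lift_comp (π ≫ σ.hom)]
    simp)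
  inv_hom_id := h.eq_id_of_comp_eq (by
    rw [Category.assoc, h.lift_comp (π ≫ σ.hom), ← Category.assoc, h.lift_comp (π ≫ σ.inv)]
    simp)

/-- The lifted automorphism lies over `σ`: `σ♯ ≫ π = π ≫ σ`. [folklore] -/
@[reassoc (attr := simp)]
theorem liftAut_hom_comp (h : IsBlowup π I) (σ : Aut X) (hσ : I.comap σ.hom = I) :
    (h.liftAut σ hσ).hom ≫ π = π ≫ σ.hom :=
  h.lift_comp (π ≫ σ.hom) (h.isEffectiveCartier_comap_comp_aut σ hσ)

/-- The inverse of the lifted automorphism lies over `σ⁻¹`. [folklore] -/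
@[reassoc (attr := simp)]
theorem liftAut_inv_comp (h : IsBlowup π I) (σ : Aut X) (hσ : I.comap σ.hom = I) :
    (h.liftAut σ hσ).inv ≫ π = π ≫ σ.inv :=
  h.lift_comp (π ≫ σ.inv) (h.isEffectiveCartier_comap_comp_aut σ.symm (comap_aut_inv_eq σ hσ))

/-- Uniqueness of the lift: an endomorphism of `X'` lying over `σ` is `σ♯`. [folklore] -/
theorem liftAut_unique (h : IsBlowup π I) (σ : Aut X) (hσ : I.comap σ.hom = I) {τ : X' ⟶ X'}
    (hτ : τ ≫ π = π ≫ σ.hom) : τ = (h.liftAut σ hσ).hom :=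
  h.lift_unique (π ≫ σ.hom) (h.isEffectiveCartier_comap_comp_aut σ hσ) hτ

/-- The lift of the identity is the identity. [folklore] -/
theorem liftAut_one (h : IsBlowup π I) (hσ : I.comap (1 : Aut X).hom = I) :
    h.liftAut 1 hσ = 1 := by
  ext : 1
  symm
  refine h.liftAut_unique 1 hσ ?_
  change 𝟙 X' ≫ π = π ≫ 𝟙 X
  simp

/-! ## A group action -/

variable {G : Type*} [Group G]

/-- **An action preserving the centre lifts to the blow-up**: for `ρ : G →* Aut X` with
`(ρ g)⁻¹ I = I` for all `g`, the lifts `(ρ g)♯` form an action `G →* Aut X'` (multiplicativity by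
uniqueness of lifts; recall `(a * b).hom = b.hom ≫ a.hom` in `Aut`).
[cite: GortzWedhorn2020, Prop. 13.91 (1)] -/
def liftAction (h : IsBlowup π I) (ρ : G →* Aut X) (hρ : ∀ g : G, I.comap (ρ g).hom = I) :
    G →* Aut X' :=
  MonoidHom.mk' (fun g => h.liftAut (ρ g) (hρ g)) fun a b => by
    ext : 1
    change (h.liftAut (ρ (a * b)) (hρ (a * b))).hom =
      (h.liftAut (ρ b) (hρ b)).hom ≫ (h.liftAut (ρ a) (hρ a)).hom
    symm
    refine h.liftAut_unique (ρ (a * b)) (hρ (a * b)) ?_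
    rw [map_mul]
    change _ = π ≫ ((ρ b).hom ≫ (ρ a).hom)
    rw [Category.assoc, liftAut_hom_comp, liftAut_hom_comp_assoc]

/-- Unfolding `liftAction`. [folklore] -/
theorem liftAction_apply (h : IsBlowup π I) (ρ : G →* Aut X)
    (hρ : ∀ g : G, I.comap (ρ g).hom = I) (g : G) :
    h.liftAction ρ hρ g = h.liftAut (ρ g) (hρ g) :=
  rfl

/-- **`π` is equivariant** for the lifted action: `(ρ♯ g) ≫ π = π ≫ (ρ g)`. [folklore] -/
@[reassoc (attr := simp)]
theorem liftAction_hom_comp (h : IsBlowup π I) (ρ : G →* Aut X)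
    (hρ : ∀ g : G, I.comap (ρ g).hom = I) (g : G) :
    (h.liftAction ρ hρ g).hom ≫ π = π ≫ (ρ g).hom :=
  h.liftAut_hom_comp (ρ g) (hρ g)

/-- Uniqueness of the equivariant structure: any action `ρ'` on `X'` for which `π` is equivariant
is the lifted action. [folklore] -/
theorem liftAction_unique (h : IsBlowup π I) (ρ : G →* Aut X)
    (hρ : ∀ g : G, I.comap (ρ g).hom = I) (ρ' : G →* Aut X')
    (hρ' : ∀ g : G, (ρ' g).hom ≫ π = π ≫ (ρ g).hom) : ρ' = h.liftAction ρ hρ := by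
  ext g : 2
  exact h.liftAut_unique (ρ g) (hρ g) (hρ' g)

/-- If the action on `X` is over a base `q : X → Y` (`(ρ g) ≫ q = q`), the lifted action is over
`Y` along `π ≫ q`. [folklore] -/
theorem liftAction_hom_comp_comp {Y : Scheme.{u}} (h : IsBlowup π I) (ρ : G →* Aut X)
    (hρ : ∀ g : G, I.comap (ρ g).hom = I) (q : X ⟶ Y) (hq : ∀ g : G, (ρ g).hom ≫ q = q)
    (g : G) : (h.liftAction ρ hρ g).hom ≫ π ≫ q = π ≫ q := by
  rw [liftAction_hom_comp_assoc, hq]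

end IsBlowup

/-! ## Stable reduced centres: the vanishing ideal of a stable closed subset is stable

The hypothesis `I.comap σ.hom = I` of `IsBlowup.liftAut` / `IsBlowup.liftAction` for the centre a
blow-up in equivariant geometry actually uses: the REDUCED closed subscheme on a closed subset `Z`
stable under the automorphism (Mathlib's `Scheme.IdealSheafData.vanishingIdeal Z`). -/

section Stable

variable {X Y : Scheme.{u}}

/-- Along an isomorphism, pulling back an ideal sheaf is pushing it forward along the inverse
(both are the inverse of the order isomorphism `comap e.inv`). [folklore] -/
theorem comap_hom_eq_map_inv (I : Y.IdealSheafData) (e : X ≅ Y) :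
    I.comap e.hom = I.map e.inv := by
  apply le_antisymm
  · rw [Scheme.IdealSheafData.le_map_iff_comap_le, ← Scheme.IdealSheafData.comap_comp,
      e.inv_hom_id, Scheme.IdealSheafData.comap_id]
  · -- `comap e.inv` reflects the order (its inverse `comap e.hom` is monotone)
    have h : (I.map e.inv).comap e.inv ≤ (I.comap e.hom).comap e.inv := by
      rw [← Scheme.IdealSheafData.comap_comp, e.inv_hom_id, Scheme.IdealSheafData.comap_id]
      exact Scheme.IdealSheafData.comap_map_le I e.inv
    have h' := Scheme.IdealSheafData.comap_mono e.hom h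
    simp only at h'
    rwa [← Scheme.IdealSheafData.comap_comp, ← Scheme.IdealSheafData.comap_comp, e.hom_inv_id,
      Scheme.IdealSheafData.comap_id, Scheme.IdealSheafData.comap_id] at h'

/-- The image of a closed subset under the inverse of an isomorphism of schemes is its preimage
under the isomorphism. [folklore] -/
theorem image_inv_eq_preimage_hom (e : X ≅ Y) (Z : Set Y) :
    e.inv.base '' Z = e.hom.base ⁻¹' Z := by
  ext x
  constructor
  · rintro ⟨z, hz, rfl⟩
    change (e.inv ≫ e.hom).base z ∈ Z
    rw [e.inv_hom_id]
    simpa only [Scheme.Hom.id_base, TopCat.coe_id, id_eq] using hz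
  · intro hx
    refine ⟨e.hom.base x, hx, ?_⟩
    change (e.hom ≫ e.inv).base x = x
    rw [e.hom_inv_id]
    simp only [Scheme.Hom.id_base, TopCat.coe_id, id_eq]

/-- **Pull-back of a vanishing ideal along an isomorphism**: `e⁻¹ 𝓘_Z = 𝓘_{e⁻¹ Z}` for the
reduced (vanishing) ideal sheaf of a closed subset `Z ⊆ Y` and an isomorphism `e : X ≅ Y`.
[folklore] -/
theorem vanishingIdeal_comap_hom (e : X ≅ Y) (Z : TopologicalSpace.Closeds Y) :
    (Scheme.IdealSheafData.vanishingIdeal Z).comap e.hom =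
      Scheme.IdealSheafData.vanishingIdeal (Z.preimage e.hom.base.hom.continuous) := by
  rw [comap_hom_eq_map_inv, Scheme.IdealSheafData.map_vanishingIdeal]
  congr 1
  apply TopologicalSpace.Closeds.ext
  rw [TopologicalSpace.Closeds.coe_closure, TopologicalSpace.Closeds.coe_preimage,
    image_inv_eq_preimage_hom]
  exact (Z.isClosed.preimage e.hom.base.hom.continuous).closure_eq

/-- **The vanishing ideal of a stable closed subset is stable**: if the automorphism `σ` of `X`
maps the closed subset `Z` into itself set-theoretically (`σ⁻¹ Z = Z`), then `σ⁻¹ 𝓘_Z = 𝓘_Z` for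
its reduced ideal sheaf — the hypothesis of `IsBlowup.liftAut`. [folklore] -/
theorem vanishingIdeal_comap_eq_of_preimage_eq (σ : X ≅ X) (Z : TopologicalSpace.Closeds X)
    (hZ : σ.hom.base ⁻¹' (Z : Set X) = Z) :
    (Scheme.IdealSheafData.vanishingIdeal Z).comap σ.hom =
      Scheme.IdealSheafData.vanishingIdeal Z := by
  rw [vanishingIdeal_comap_hom]
  congr 1
  exact TopologicalSpace.Closeds.ext (by rw [TopologicalSpace.Closeds.coe_preimage]; exact hZ)

/-- **A group action preserving a closed subset preserves its vanishing ideal**: for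
`ρ : G →* Aut X` with `(ρ g)⁻¹ Z = Z` for all `g`, the reduced ideal sheaf `𝓘_Z` satisfies the
hypothesis of `IsBlowup.liftAction`, so the action lifts to the blow-up of `X` along the reduced
centre `Z`. [folklore] -/
theorem vanishingIdeal_comap_eq_of_action {G : Type*} [Group G] (ρ : G →* Aut X)
    (Z : TopologicalSpace.Closeds X) (hZ : ∀ g : G, (ρ g).hom.base ⁻¹' (Z : Set X) = Z) (g : G) :
    (Scheme.IdealSheafData.vanishingIdeal Z).comap (ρ g).hom =
      Scheme.IdealSheafData.vanishingIdeal Z :=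
  vanishingIdeal_comap_eq_of_preimage_eq (ρ g) Z (hZ g)

/-- The lifted action on the blow-up along the reduced centre on a `G`-stable closed subset `Z`,
packaged: `π` is `G`-equivariant for `IsBlowup.liftAction` with the stability witness
`vanishingIdeal_comap_eq_of_action`. [folklore] -/
theorem IsBlowup.liftAction_hom_comp_vanishingIdeal {X' : Scheme.{u}} {π : X' ⟶ X}
    {Z : TopologicalSpace.Closeds X} (h : IsBlowup π (Scheme.IdealSheafData.vanishingIdeal Z))
    {G : Type*} [Group G] (ρ : G →* Aut X)
    (hZ : ∀ g : G, (ρ g).hom.base ⁻¹' (Z : Set X) = Z) (g : G) :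
    (h.liftAction ρ (vanishingIdeal_comap_eq_of_action ρ Z hZ) g).hom ≫ π = π ≫ (ρ g).hom :=
  h.liftAction_hom_comp ρ _ g

end Stable

end Literature.AlgebraicGeometry.Resolution

end
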